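import Literature.NumberTheory.Sieve.MoebiusShiftedPrimesMinorArcWith
import HarnessLib

/-!
# Möbius on shifted primes — the arcs of Lichtman 2020, §3, with decoupled parameters

Topic `Literature/NumberTheory/Sieve`.  Part of the work on the named fact
`Literature.NumberTheory.Sieve.Lichtman2020_keyFourierEstimate` (J. D. Lichtman, *Averages of the
Möbius function on shifted primes*, Q. J. Math. 73 (2022) 729–757, doi:10.1093/qmath/haab054,
arXiv:2009.08969v2 [Lichtman2020], Theorem 2.2 AS PRINTED, i.e. along the printed typical set
`S(X,A,δ)` of (2.3)–(2.4) with first interval `[P₁, Q₁] = [(log X)^{33A}, H/(log X)^{4A}]`).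
Page numbers refer to the held copy `paper:arxiv-2009.08969`.

## Why this file

`MoebiusShiftedPrimesTypical.lean` records that the printed proof of Proposition 5.1 (p. 15) does not
close with the printed parameters (`V/(1 - e^{-2α/V})` is `≍ V²`, not `O(1)`), and re-targets the whole
chain along the enlarged sets `S_c`, `c ≥ 100`.  The printed STATEMENT of Theorem 2.2 (set `S = S₃₃`)
is nevertheless reachable by the printed method once the INTERNAL parameters of §§3–5 are re-balanced
(the set `S`, hence the statement, being untouched): with `L = log X`, `W = L^A`,
* moduli `d = e²` with `e ≤ ⌈L^{A/5}⌉` in the passage `μ = λ * h` (tail `≪ HX/L^{A/5}`);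
* major arcs `⋃_{q ≤ W_m} 𝔐(q)` with threshold `W_m = L^{0.4A + 3/2}` and width `|α - a/q| ≤ Θ/(qH)`,
  `Θ = L^{0.8A+2}` (print: `W_m = W`, `Θ = W⁴`);
* the major-arc threshold `h ≥ qH/W_b` and mean square `J ≪ h²Y/W_b²` with `W_b = L^{A+2}` (print:
  `W⁵`, `W^{10}`), so that `Q₁/h ≤ 1` and Proposition 5.1 is only needed with saving `(log X)^{-B}`,
  `B = 2A + 4` (print: `B = 11A`), which the first interval `P₁ = L^{33A}` affords
  (`3B + 1 ≤ 66αA` with `α = 1/7`).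
The fixed-`X` lemmas of the tree for §3 (`Lichtman2020.block_numeric_bound`, `block_bound`,
`minorArc_sum_le'`, `majorArc_fixed_bound`, `keyFourier_fixed_bound_general`) hard-wire the printed
couplings (`level = set-top = H/W⁴`, threshold `W`, `h ≥ H/W⁵`, `J ≪ h²Y/W^{10}`, moduli `e ≤ √W`).
This file proves the same lemmas with those couplings turned into explicit hypotheses; the proofs are
those of the tree, line by line.  Nothing here is a new named fact.

## Content (all PROVED)

* `Lichtman2020.block_numeric_bound_gen`, `Lichtman2020.block_bound_gen`,
  `Lichtman2020.minorArc_sum_le_gen` — §3.1 (pp. 9–10) at a fixed `X` for a threshold `W`, a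
  Dirichlet level `Q₁` (the minor arcs `𝔪(W, Q₁)`) and a set `S` built on `[P₁, Q₁'] ∪ [P₂, Q₂]` with
  `Q₁'` decoupled from `Q₁`, under the size hypotheses `W³³ ≤ P₁`, `Q₁ d W ≤ H`, `2 Q₁' d W ≤ H`,
  `2 d W ≤ H`: `∑_{k ≤ X} |∑_{n ∈ windowDiv d H k ∩ S} g(n) e(nα)| ≤ 600 HX log H/(d√W)`.
* `Lichtman2020.majorArc_fixed_bound_gen` — §3.2 (pp. 10–11) at a fixed `X` for `α = a/q + θ`,
  `|θ| ≤ Θ/(qH)`, a threshold parameter `W_b` (`I_h ≪ qhX/W_b` for `h ≥ qH/W_b` from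
  `J ≪ h²Y/W_b²` on `Y ∈ [X/(dW_b), X]`), under `q ≤ Θ`, `2qd ≤ W_b`, `W_b² ≤ H`, `d W_b ≤ X`:
  `∑_{k ≤ X} |∑_{k ≤ md < k+H, m ∈ S} λ(m) e(mα)| ≤ C' HX Θ/(d W_b)`.
* `Lichtman2020.keyFourier_fixed_bound_M` — Theorem 2.2 at a fixed `X` from per-modulus bounds
  `B(e²)`, `e ≤ M`, with the tail `4HX/M` (variant of `keyFourier_fixed_bound_general`, whose `M`
  is `⌊√W⌋`).

## Source

* J. D. Lichtman, arXiv:2009.08969v2, §2 pp. 7–8 ((2.9)–(2.11)), §3.1 pp. 9–10 ((3.1)–(3.6),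
  Lemma 3.3), §3.2 pp. 10–11 ((3.8)–(3.13)) [Lichtman2020].
-/

open Filter Asymptotics Finset MeasureTheory
open scoped FourierTransform Topology

namespace Literature.NumberTheory.Sieve.Lichtman2020

/-! ### §3.1 with decoupled threshold, level and set-top -/

/-- The numeric heart of the block estimate with the size relations as hypotheses (generalising
`block_numeric_bound`, where `P ≥ W³³/2`, `P ≤ Q₁ = H/W⁴`, `d ≤ W` imply them): for `2 ≤ W`,
`1 ≤ d`, `2W ≤ P`, `2P·dW ≤ H`, `Q₁·dW ≤ H`, `2dW ≤ H ≤ X`, the quantity `M · 5HX · V` of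
`core_block_bound` (`M ≤ (X+H)/(dP)`, `U ≤ H/(dP) + 1`, `#Q ≤ 12P/log(2P)`,
`V ≤ #Q·U + 2#Q·4(2PU/W + 2P + Q₁)L₁`, `L₁ ≤ Λ`) is at most `4920 H²X²Λ/(d²W log(2P))`. [folklore] -/
theorem block_numeric_bound_gen {X H d W P Q₁ Λ M U cQ L₁ V : ℝ} (hW : 2 ≤ W) (hd : 1 ≤ d)
    (hP : 2 * W ≤ P) (hPH : 2 * P * (d * W) ≤ H) (hQ₁0 : 0 ≤ Q₁) (hQ₁H : Q₁ * (d * W) ≤ H)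
    (hdWH : 2 * (d * W) ≤ H) (hHX : H ≤ X)
    (hM0 : 0 ≤ M) (hM : M ≤ (X + H) / (d * P)) (hU0 : 0 ≤ U) (hU : U ≤ H / (d * P) + 1)
    (hcQ0 : 0 ≤ cQ) (hlog : 0 < Real.log (2 * P)) (hcQ : cQ ≤ 12 * P / Real.log (2 * P))
    (hL₁0 : 0 ≤ L₁) (hL₁ : L₁ ≤ Λ) (hΛ : 1 ≤ Λ)
    (hV : V ≤ cQ * U + 2 * cQ * (4 * (2 * P * U / W + 2 * P + Q₁) * L₁)) :
    M * (5 * H * X * V) ≤ 4920 * (H ^ 2 * X ^ 2 * Λ / (d ^ 2 * W * Real.log (2 * P))) := by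
  have hW0 : 0 < W := by linarith
  have hd0 : 0 < d := by linarith
  have hdW0 : 0 < d * W := mul_pos hd0 hW0
  have hP0 : 0 < P := by nlinarith
  have hH0 : 0 < H := by nlinarith
  have hX0 : 0 < X := by linarith
  set R : ℝ := H / (d * W) with hR
  have hR0 : 0 < R := by positivity
  -- (1) `U ≤ R`
  have h1a : H / (d * P) ≤ R / 2 := by
    calc H / (d * P) ≤ H / (d * (2 * W)) :=
          div_le_div_of_nonneg_left hH0.le (by positivity) (mul_le_mul_of_nonneg_left hP hd0.le)
      _ = R / 2 := by rw [hR]; field_simp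
  have h1b : 1 ≤ R / 2 := by
    rw [hR, le_div_iff₀ (by norm_num), le_div_iff₀ hdW0]
    linarith
  have hUR : U ≤ R := by linarith
  -- (2) `2PU/W ≤ 3R`, (3) `2P ≤ R`, (4) `Q₁ ≤ R`
  have hPU : P * U ≤ H / d + P := by
    calc P * U ≤ P * (H / (d * P) + 1) := mul_le_mul_of_nonneg_left hU hP0.le
      _ = H / d + P := by field_simp
  have h2P : 2 * P ≤ R := by
    rw [hR, le_div_iff₀ hdW0]
    exact hPH
  have h2a : 2 * P * U / W ≤ 3 * R := by
    have h5 : 2 * P * U / W ≤ 2 * (H / d + P) / W :=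
      div_le_div_of_nonneg_right (by linarith) hW0.le
    have h6 : 2 * (H / d + P) / W = 2 * R + 2 * P / W := by rw [hR]; field_simp
    have h7 : 2 * P / W ≤ R := by
      calc 2 * P / W ≤ 2 * P / 1 := div_le_div_of_nonneg_left (by positivity) one_pos (by linarith)
        _ = 2 * P := div_one _
        _ ≤ R := h2P
    linarith
  have hQR : Q₁ ≤ R := by
    rw [hR, le_div_iff₀ hdW0]
    exact hQ₁H
  -- (5) `V ≤ 41 cQ R Λ ≤ 492 P R Λ / log(2P)`
  have hin : 4 * (2 * P * U / W + 2 * P + Q₁) * L₁ ≤ 20 * R * Λ := by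
    have h8 : 2 * P * U / W + 2 * P + Q₁ ≤ 5 * R := by linarith
    have h9 : 0 ≤ 2 * P * U / W + 2 * P + Q₁ :=
      add_nonneg (add_nonneg (by positivity) (by positivity)) hQ₁0
    calc 4 * (2 * P * U / W + 2 * P + Q₁) * L₁ ≤ 4 * (5 * R) * Λ :=
          mul_le_mul (by linarith) hL₁ hL₁0 (by positivity)
      _ = 20 * R * Λ := by ring
  have hV1 : V ≤ 41 * cQ * R * Λ := by
    have h10 : cQ * U ≤ cQ * R * Λ := by
      calc cQ * U ≤ cQ * R := mul_le_mul_of_nonneg_left hUR hcQ0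
        _ = cQ * R * 1 := (mul_one _).symm
        _ ≤ cQ * R * Λ := mul_le_mul_of_nonneg_left hΛ (by positivity)
    have h11 : 2 * cQ * (4 * (2 * P * U / W + 2 * P + Q₁) * L₁) ≤ 2 * cQ * (20 * R * Λ) :=
      mul_le_mul_of_nonneg_left hin (by positivity)
    linarith
  have hV2 : V ≤ 492 * (P * R * Λ / Real.log (2 * P)) := by
    calc V ≤ 41 * cQ * R * Λ := hV1
      _ = cQ * (41 * R * Λ) := by ring
      _ ≤ 12 * P / Real.log (2 * P) * (41 * R * Λ) :=
          mul_le_mul_of_nonneg_right hcQ (by positivity)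
      _ = 492 * (P * R * Λ / Real.log (2 * P)) := by field_simp; ring
  -- (6) `M ≤ 2X/(dP)` and assembly
  have hM2 : M ≤ 2 * X / (d * P) := by
    refine hM.trans (div_le_div_of_nonneg_right (by linarith) (by positivity))
  have hB0 : 0 ≤ 492 * (P * R * Λ / Real.log (2 * P)) := by positivity
  calc M * (5 * H * X * V) ≤ M * (5 * H * X * (492 * (P * R * Λ / Real.log (2 * P)))) := by
        apply mul_le_mul_of_nonneg_left _ hM0
        exact mul_le_mul_of_nonneg_left hV2 (by positivity)
    _ ≤ 2 * X / (d * P) * (5 * H * X * (492 * (P * R * Λ / Real.log (2 * P)))) :=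
        mul_le_mul_of_nonneg_right hM2 (by positivity)
    _ = 4920 * (H ^ 2 * X ^ 2 * Λ / (d ^ 2 * W * Real.log (2 * P))) := by
        rw [hR]
        field_simp
        ring

/-- **One dyadic block on the minor arcs, decoupled form** (as `block_bound`, with the level `Q₁` of
the minor arcs `𝔪(W, Q₁)` no longer tied to `H/W⁴` nor to the block range): for a block `Q` of primes
in `[2^j, 2^{j+1})` with `2W ≤ 2^j`, `2·2^j·dW ≤ H`, `2·2^j ≤ H`, `Q₁ dW ≤ H`, `1 ≤ Q₁ ≤ H`, `2dW ≤ H`,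
`3 ≤ H ≤ X`, and `α ∈ 𝔪(W, Q₁)`,
`∑_k |G_j(k)| ≤ 86 · HX √(1 + 2 log H)/(d√W) · (j+1)^{-1/2}`. [cite: Lichtman2020, §3.1, (3.4)–(3.6)] -/
theorem block_bound_gen {X d H j : ℕ} {W Q₁ : ℝ} (hW : 2 ≤ W) (hd : 1 ≤ d)
    (hH : 3 ≤ H) (hHX : H ≤ X) (Q : Finset ℕ)
    (hQpr : ∀ p ∈ Q, p.Prime) (hQ : ∀ p ∈ Q, 2 ^ j ≤ p ∧ p < 2 * 2 ^ j)
    (hPW : 2 * W ≤ (2 : ℝ) ^ j) (hPH : 2 * (2 : ℝ) ^ j * ((d : ℝ) * W) ≤ H)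
    (h2PH : 2 * (2 : ℝ) ^ j ≤ H) (hQ₁dW : Q₁ * ((d : ℝ) * W) ≤ H) (hQ₁1 : 1 ≤ Q₁)
    (hQ₁H : Q₁ ≤ H) (hdWH : 2 * ((d : ℝ) * W) ≤ H)
    (c w : ℕ → ℂ) (hc : ∀ m, ‖c m‖ ≤ 1) (hw : ∀ p, ‖w p‖ ≤ 1)
    {α : ℝ} (hα : α ∈ lichtmanMinorArcs W Q₁) :
    ∑ k ∈ Icc 1 X, ‖∑ p ∈ Q, ∑ m ∈ windowDiv (d * p) H k,
        c m * w p * (𝐞 (((m * p : ℕ) : ℝ) * α) : ℂ)‖ ≤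
      86 * ((H : ℝ) * X * Real.sqrt (1 + 2 * Real.log H) / (d * Real.sqrt W)) *
        (1 / Real.sqrt ((j : ℝ) + 1)) := by
  have hW0 : 0 < W := by linarith
  have hd1 : (1 : ℝ) ≤ d := by exact_mod_cast hd
  have hH3 : (3 : ℝ) ≤ H := by exact_mod_cast hH
  have hH0 : (0 : ℝ) < H := by linarith
  have hHX' : (H : ℝ) ≤ X := by exact_mod_cast hHX
  have hlogH : 1 ≤ Real.log H := by
    rw [Real.le_log_iff_exp_le hH0]
    have := Real.exp_one_lt_d9
    linarith
  set Λ : ℝ := 1 + 2 * Real.log H with hΛ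
  have hΛ1 : 1 ≤ Λ := by rw [hΛ]; linarith
  have hP1 : 1 ≤ 2 ^ j := Nat.one_le_two_pow
  have hP0 : (0 : ℝ) < (2 : ℝ) ^ j := by positivity
  have hdP0 : (0 : ℝ) < (d : ℝ) * (2 : ℝ) ^ j := by positivity
  have hrhs0 : 0 ≤ 86 * ((H : ℝ) * X * Real.sqrt Λ / (d * Real.sqrt W)) *
      (1 / Real.sqrt ((j : ℝ) + 1)) := by positivity
  -- the core estimate and the abbreviations `M, U, V, L₁`
  have hcore := core_block_bound (X := X) (H := H) hd hP1 Q hQ c w hc hw α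
  set M : ℕ := (X + H - 1) / (d * 2 ^ j) with hMdef
  set Un : ℕ := (H - 1) / (d * 2 ^ j) with hUndef
  set U : ℝ := (Un : ℝ) + 1 with hUdef
  have hU0 : 0 ≤ U := by positivity
  have hV1 := sum_sum_geomBound_sub_le Q hQ hU0 α
  have hV2 := sum_geomBound_const_le_of_mem_minorArcs hW0 hQ₁1 hα hU0 hP1
  push_cast at hV2
  set V : ℝ := ∑ p₁ ∈ Q, ∑ p₂ ∈ Q, Vinogradov.geomBound U (((p₁ : ℝ) - p₂) * α) with hVdef
  set L₁ : ℝ := 1 + Real.log (Q₁ * (2 * (2 : ℝ) ^ j)) with hL₁def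
  -- the hypotheses of the numeric lemma
  have hM : (M : ℝ) ≤ ((X : ℝ) + H) / ((d : ℝ) * (2 : ℝ) ^ j) := by
    rw [le_div_iff₀ hdP0]
    have h1 : M * (d * 2 ^ j) ≤ X + H - 1 := Nat.div_mul_le_self _ _
    have h2 : ((M * (d * 2 ^ j) : ℕ) : ℝ) ≤ ((X + H - 1 : ℕ) : ℝ) := by exact_mod_cast h1
    have h3 : ((X + H - 1 : ℕ) : ℝ) ≤ (X : ℝ) + H := by
      rw [Nat.cast_sub (by omega), Nat.cast_add]; simp
    push_cast at h2
    linarith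
  have hU : U ≤ (H : ℝ) / ((d : ℝ) * (2 : ℝ) ^ j) + 1 := by
    rw [hUdef, add_le_add_iff_right, le_div_iff₀ hdP0]
    have h1 : Un * (d * 2 ^ j) ≤ H - 1 := Nat.div_mul_le_self _ _
    have h2 : ((Un * (d * 2 ^ j) : ℕ) : ℝ) ≤ ((H - 1 : ℕ) : ℝ) := by exact_mod_cast h1
    have h3 : ((H - 1 : ℕ) : ℝ) ≤ (H : ℝ) := by exact_mod_cast Nat.sub_le H 1
    push_cast at h2
    linarith
  have hcQ0 : (0 : ℝ) ≤ (#Q : ℝ) := Nat.cast_nonneg _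
  have hV : V ≤ #Q * U + 2 * #Q * (4 * (2 * (2 : ℝ) ^ j * U / W + 2 * (2 : ℝ) ^ j + Q₁) * L₁) := by
    have h2c : (0 : ℝ) ≤ 2 * (#Q : ℝ) := by linarith
    have h3 := mul_le_mul_of_nonneg_left hV2 h2c
    rw [hL₁def]
    calc V ≤ _ := hV1
      _ ≤ _ := by linarith
  have hQ0 : 0 ≤ Q₁ := by linarith
  have hQP2 : Q₁ * (2 * (2 : ℝ) ^ j) ≤ (H : ℝ) ^ 2 := by
    calc Q₁ * (2 * (2 : ℝ) ^ j) ≤ (H : ℝ) * H := mul_le_mul hQ₁H h2PH (by positivity) hH0.le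
      _ = (H : ℝ) ^ 2 := (sq _).symm
  have hQP1 : 1 ≤ Q₁ * (2 * (2 : ℝ) ^ j) := by
    have h1 : (1 : ℝ) ≤ (2 : ℝ) ^ j := one_le_pow₀ (by norm_num)
    have h2 : (1 : ℝ) * 1 ≤ Q₁ * (2 * (2 : ℝ) ^ j) :=
      mul_le_mul hQ₁1 (by linarith) zero_le_one hQ0
    linarith
  have hL₁Λ : L₁ ≤ Λ := by
    rw [hL₁def, hΛ]
    have h := Real.log_le_log (by linarith) hQP2
    rw [Real.log_pow] at h
    push_cast at h
    linarith
  have hL₁0 : 0 ≤ L₁ := by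
    rw [hL₁def]
    have := Real.log_nonneg hQP1
    linarith
  have h2P2 : 2 ≤ 2 * 2 ^ j := by omega
  have h2P2' : (2 : ℝ) ≤ 2 * (2 : ℝ) ^ j := by
    have h1 : (1 : ℝ) ≤ (2 : ℝ) ^ j := one_le_pow₀ (by norm_num)
    linarith
  have hlog2P : 0 < Real.log (2 * (2 : ℝ) ^ j) := Real.log_pos (by linarith)
  have hcard : (#Q : ℝ) ≤ 12 * (2 : ℝ) ^ j / Real.log (2 * (2 : ℝ) ^ j) := by
    have h1 : #Q ≤ Nat.primeCounting (2 * 2 ^ j) :=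
      card_le_primeCounting_of_prime Q (fun p hp => ⟨hQpr p hp, (hQ p hp).2.le⟩)
    have h2 := primeCounting_le_six_mul_div_log h2P2
    push_cast at h2
    calc (#Q : ℝ) ≤ Nat.primeCounting (2 * 2 ^ j) := by exact_mod_cast h1
      _ ≤ 6 * ((2 * (2 : ℝ) ^ j) / Real.log (2 * 2 ^ j)) := h2
      _ = 12 * (2 : ℝ) ^ j / Real.log (2 * 2 ^ j) := by ring
  have hPH' : 2 * (2 : ℝ) ^ j * ((d : ℝ) * W) ≤ H := hPH
  have hnum := block_numeric_bound_gen (X := (X : ℝ)) (H := (H : ℝ)) (d := (d : ℝ)) hW hd1 hPW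
    hPH' hQ0 hQ₁dW hdWH hHX' (Nat.cast_nonneg M) hM hU0 hU hcQ0 hlog2P hcard hL₁0 hL₁Λ hΛ1 hV
  -- `√(4920 K/((j+1) log 2)) ≤ 86 √K/√(j+1)`
  have hlogeq : Real.log (2 * (2 : ℝ) ^ j) = ((j : ℝ) + 1) * Real.log 2 := by
    rw [← pow_succ', Real.log_pow]
    push_cast
    ring
  have hj0 : (0 : ℝ) < (j : ℝ) + 1 := by positivity
  have hsq : 4920 * ((H : ℝ) ^ 2 * (X : ℝ) ^ 2 * Λ / ((d : ℝ) ^ 2 * W * Real.log (2 * (2 : ℝ) ^ j))) ≤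
      (86 * ((H : ℝ) * X * Real.sqrt Λ / (d * Real.sqrt W)) * (1 / Real.sqrt ((j : ℝ) + 1))) ^ 2 := by
    have hK0 : 0 ≤ (H : ℝ) ^ 2 * (X : ℝ) ^ 2 * Λ / ((d : ℝ) ^ 2 * W) := by positivity
    have hrhs : (86 * ((H : ℝ) * X * Real.sqrt Λ / (d * Real.sqrt W)) *
        (1 / Real.sqrt ((j : ℝ) + 1))) ^ 2 =
        7396 / ((j : ℝ) + 1) * ((H : ℝ) ^ 2 * (X : ℝ) ^ 2 * Λ / ((d : ℝ) ^ 2 * W)) := by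
      rw [mul_pow, mul_pow, div_pow, div_pow, mul_pow, mul_pow, mul_pow, one_pow,
        Real.sq_sqrt (by linarith), Real.sq_sqrt hW0.le, Real.sq_sqrt hj0.le]
      field_simp
      ring
    have hlhs : 4920 * ((H : ℝ) ^ 2 * (X : ℝ) ^ 2 * Λ /
        ((d : ℝ) ^ 2 * W * Real.log (2 * (2 : ℝ) ^ j))) =
        4920 / Real.log (2 * (2 : ℝ) ^ j) * ((H : ℝ) ^ 2 * (X : ℝ) ^ 2 * Λ / ((d : ℝ) ^ 2 * W)) := by
      field_simp
    rw [hrhs, hlhs]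
    apply mul_le_mul_of_nonneg_right _ hK0
    rw [div_le_div_iff₀ hlog2P hj0, hlogeq]
    have h4 := two_thirds_le_log_two
    have h5 : ((j : ℝ) + 1) * (2 / 3) ≤ ((j : ℝ) + 1) * Real.log 2 :=
      mul_le_mul_of_nonneg_left h4 hj0.le
    linarith
  calc ∑ k ∈ Icc 1 X, ‖∑ p ∈ Q, ∑ m ∈ windowDiv (d * p) H k,
        c m * w p * (𝐞 (((m * p : ℕ) : ℝ) * α) : ℂ)‖ ≤ Real.sqrt ((M : ℝ) * (5 * H * X * V)) := hcore
    _ ≤ Real.sqrt (4920 * ((H : ℝ) ^ 2 * (X : ℝ) ^ 2 * Λ /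
        ((d : ℝ) ^ 2 * W * Real.log (2 * (2 : ℝ) ^ j)))) := Real.sqrt_le_sqrt hnum
    _ ≤ Real.sqrt ((86 * ((H : ℝ) * X * Real.sqrt Λ / (d * Real.sqrt W)) *
        (1 / Real.sqrt ((j : ℝ) + 1))) ^ 2) := Real.sqrt_le_sqrt hsq
    _ = 86 * ((H : ℝ) * X * Real.sqrt Λ / (d * Real.sqrt W)) *
        (1 / Real.sqrt ((j : ℝ) + 1)) := Real.sqrt_sq hrhs0

/-- **The minor arc bound of §3.1 at a fixed `X`, decoupled form** (as `minorArc_sum_le'`, with the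
Dirichlet level `Q₁` of the minor arcs `𝔪(W, Q₁)`, the top `Q₁'` of the first interval of `S` and
the threshold `W` decoupled): for `2 ≤ W`, `1 ≤ d`, `W³³ ≤ P₁`, `1 ≤ Q₁`, `Q₁ dW ≤ H`, `0 ≤ Q₁'`,
`2Q₁' dW ≤ H`, `2dW ≤ H`, `Q₁' < P₂`, `3 ≤ H ≤ X`, `S(n) ⟺` (`n` has a prime factor in `[P₁, Q₁']` and
one in `[P₂, Q₂]`), `g` completely multiplicative with `|g| ≤ 1` and `α ∈ 𝔪(W, Q₁)`:
`∑_{k ≤ X} |∑_{n ∈ windowDiv d H k ∩ S} g(n) e(nα)| ≤ 600 · HX log H/(d√W)`.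
[cite: Lichtman2020, §3.1, (3.1)–(3.6)] -/
theorem minorArc_sum_le_gen {X d H : ℕ} {W P₁ Q₁ Q₁' P₂ Q₂ : ℝ} (hW : 2 ≤ W) (hd : 1 ≤ d)
    (hP₁ : W ^ 33 ≤ P₁) (hQ₁1 : 1 ≤ Q₁) (hQ₁dW : Q₁ * ((d : ℝ) * W) ≤ H)
    (hQ₁'0 : 0 ≤ Q₁') (hQ₁'dW : 2 * Q₁' * ((d : ℝ) * W) ≤ H) (hdWH : 2 * ((d : ℝ) * W) ≤ H)
    (hQP : Q₁' < P₂) (hH : 3 ≤ H) (hHX : H ≤ X) (S : ℕ → Prop) [DecidablePred S]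
    (hSiff : ∀ n, S n ↔ HasPrimeFactorIn P₁ Q₁' n ∧ HasPrimeFactorIn P₂ Q₂ n)
    (g : ℕ → ℂ) (hgmul : ∀ m n, g (m * n) = g m * g n) (hg : ∀ n, ‖g n‖ ≤ 1)
    {α : ℝ} (hα : α ∈ lichtmanMinorArcs W Q₁) :
    ∑ k ∈ Icc 1 X, ‖twistedSum g ((windowDiv d H k).filter S) α‖ ≤
      600 * ((H : ℝ) * X * Real.log H / (d * Real.sqrt W)) := by
  classical
  -- basic real facts
  have hW0 : 0 < W := by linarith
  have hW1 : 1 ≤ W := by linarith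
  have hd1 : (1 : ℝ) ≤ d := by exact_mod_cast hd
  have hdW1 : 1 ≤ (d : ℝ) * W := by nlinarith
  have hH3 : (3 : ℝ) ≤ H := by exact_mod_cast hH
  have hH0 : (0 : ℝ) < H := by linarith
  have hlogH : 1 ≤ Real.log H := by
    rw [Real.le_log_iff_exp_le hH0]
    have := Real.exp_one_lt_d9
    linarith
  have hP₁1 : 1 ≤ P₁ := le_trans (one_le_pow₀ hW1) hP₁
  have hQ₁H : Q₁ ≤ H := by
    calc Q₁ = Q₁ * 1 := (mul_one _).symm
      _ ≤ Q₁ * ((d : ℝ) * W) := mul_le_mul_of_nonneg_left hdW1 (by linarith)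
      _ ≤ H := hQ₁dW
  have hQ₁'H2 : 2 * Q₁' ≤ H := by
    calc 2 * Q₁' = 2 * Q₁' * 1 := (mul_one _).symm
      _ ≤ 2 * Q₁' * ((d : ℝ) * W) := mul_le_mul_of_nonneg_left hdW1 (by linarith)
      _ ≤ H := hQ₁'dW
  have hQ₁'H : Q₁' ≤ H := by linarith
  have hΛ3 : 1 + 2 * Real.log H ≤ 3 * Real.log H := by linarith
  -- the primes of `[P₁, Q₁']`
  set Ps : Finset ℕ := (Finset.range (⌊Q₁'⌋₊ + 1)).filter
    (fun p => p.Prime ∧ P₁ ≤ (p : ℝ) ∧ (p : ℝ) ≤ Q₁') with hPs_def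
  have hPs : ∀ p ∈ Ps, p.Prime := fun p hp => (Finset.mem_filter.mp hp).2.1
  have hPsb : ∀ p ∈ Ps, P₁ ≤ (p : ℝ) ∧ (p : ℝ) ≤ Q₁' := fun p hp => (Finset.mem_filter.mp hp).2.2
  have hPsQ : ∀ p ∈ Ps, p ≤ ⌊Q₁'⌋₊ := fun p hp => by
    have := Finset.mem_range.mp (Finset.mem_filter.mp hp).1; omega
  have hS : ∀ n, S n → n ≠ 0 ∧ ∃ p ∈ Ps, p ∣ n := by
    intro n hn
    obtain ⟨⟨p, hp, hP, hQ⟩, -⟩ := (hSiff n).mp hn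
    obtain ⟨hpr, hpn, hn0⟩ := Nat.mem_primeFactors.mp hp
    refine ⟨hn0, p, ?_, hpn⟩
    rw [hPs_def, Finset.mem_filter, Finset.mem_range]
    refine ⟨?_, hpr, hP, hQ⟩
    have : p ≤ ⌊Q₁'⌋₊ := Nat.le_floor hQ
    omega
  have hS₂ : ∀ p ∈ Ps, ∀ m, m ≠ 0 → (S (m * p) ↔ HasPrimeFactorIn P₂ Q₂ m) := by
    intro p hp m hm
    have hpr := hPs p hp
    obtain ⟨hP, hQ⟩ := hPsb p hp
    rw [hSiff]
    have h1 : HasPrimeFactorIn P₁ Q₁' (m * p) :=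
      ⟨p, Nat.mem_primeFactors.mpr ⟨hpr, dvd_mul_left p m, Nat.mul_ne_zero hm hpr.ne_zero⟩, hP, hQ⟩
    have h2 : HasPrimeFactorIn P₂ Q₂ (m * p) ↔ HasPrimeFactorIn P₂ Q₂ m := by
      rw [mul_comm]
      apply hasPrimeFactorIn_mul_iff hpr.ne_zero
      intro q hq
      rw [Nat.Prime.primeFactors hpr, Finset.mem_singleton] at hq
      rw [hq]; exact lt_of_le_of_lt hQ hQP
    rw [h2]
    exact ⟨fun h => h.2, fun h => ⟨h1, h⟩⟩
  -- the Ramaré coefficients and the dyadic blocks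
  set c : ℕ → ℂ := fun m => if HasPrimeFactorIn P₂ Q₂ m then
    g m / ((#(Ps.filter (· ∣ m)) : ℂ) + 1) else 0 with hc
  have hcle : ∀ m, ‖c m‖ ≤ 1 := fun m => norm_ramareCoeff_le Ps (HasPrimeFactorIn P₂ Q₂) g hg m
  set J : ℕ := Nat.log 2 ⌊Q₁'⌋₊ with hJ
  have hJ3 : (((J + 1 : ℕ)) : ℝ) ≤ 3 * Real.log H := log_two_floor_add_one_le hH hQ₁'H
  set Qj : ℕ → Finset ℕ := fun j => Ps.filter (fun p => Nat.log 2 p = j) with hQj_def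
  have hQjP : ∀ j, ∀ p ∈ Qj j, p ∈ Ps := fun j p hp => (Finset.mem_filter.mp hp).1
  have hQj : ∀ j, ∀ p ∈ Qj j, 2 ^ j ≤ p ∧ p < 2 * 2 ^ j := by
    intro j p hp
    obtain ⟨hpP, hj⟩ := Finset.mem_filter.mp hp
    subst hj
    have hp0 : p ≠ 0 := (hPs p hpP).ne_zero
    refine ⟨Nat.pow_log_le_self 2 hp0, ?_⟩
    rw [← pow_succ']
    exact Nat.lt_pow_succ_log_self one_lt_two p
  have hmaps : ∀ p ∈ Ps, Nat.log 2 p ∈ Finset.range (J + 1) := by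
    intro p hp
    rw [Finset.mem_range, Nat.lt_succ_iff, hJ]
    exact Nat.log_mono_right (hPsQ p hp)
  set G : ℕ → ℕ → ℂ := fun j k => ∑ p ∈ Qj j, ∑ m ∈ windowDiv (d * p) H k,
      c m * g p * (𝐞 (((m * p : ℕ) : ℝ) * α) : ℂ) with hG
  -- Step 1: per-window decomposition
  have hdecomp : ∀ k ∈ Icc 1 X, ‖twistedSum g ((windowDiv d H k).filter S) α‖ ≤
      ∑ j ∈ Finset.range (J + 1), ‖G j k‖ +
        2 * ∑ p ∈ Ps, (#(windowDiv (d * p * p) H k) : ℝ) := by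
    intro k hk
    have hk1 : 1 ≤ k := (Finset.mem_Icc.mp hk).1
    have hR := norm_twistedSum_sub_ramare_le (d := d) (H := H) hk1 Ps hPs S
      (HasPrimeFactorIn P₂ Q₂) hS hS₂ g hgmul hg α c (fun m => rfl)
    have hmain : ∑ p ∈ Ps, ∑ m ∈ windowDiv (d * p) H k,
        c m * g p * (𝐞 (((m * p : ℕ) : ℝ) * α) : ℂ) = ∑ j ∈ Finset.range (J + 1), G j k := by
      simp only [hG, hQj_def]
      exact (Finset.sum_fiberwise_of_maps_to hmaps _).symm
    calc ‖twistedSum g ((windowDiv d H k).filter S) α‖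
        = ‖(twistedSum g ((windowDiv d H k).filter S) α -
            ∑ p ∈ Ps, ∑ m ∈ windowDiv (d * p) H k,
              c m * g p * (𝐞 (((m * p : ℕ) : ℝ) * α) : ℂ)) +
            ∑ j ∈ Finset.range (J + 1), G j k‖ := by rw [← hmain, sub_add_cancel]
      _ ≤ 2 * ∑ p ∈ Ps, (#(windowDiv (d * p * p) H k) : ℝ) +
            ∑ j ∈ Finset.range (J + 1), ‖G j k‖ :=
          (norm_add_le _ _).trans (add_le_add hR (norm_sum_le _ _))
      _ = _ := by ring
  -- Step 2: the error term
  have herr := ramare_error_le' (X := X) hW hd hP₁ hH hHX Ps hPs (fun p hp => (hPsb p hp).1)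
  -- Step 3: the blocks
  have hY0 : 0 ≤ (H : ℝ) * X * Real.sqrt (1 + 2 * Real.log H) / (d * Real.sqrt W) := by positivity
  have hW33 : 2 * W ≤ W ^ 33 / 2 := by
    have hW32 : (2 : ℝ) ^ 32 ≤ W ^ 32 := pow_le_pow_left₀ (by norm_num) hW 32
    have h1 : W * 4 ≤ W * W ^ 32 :=
      mul_le_mul_of_nonneg_left (by linarith [show (4 : ℝ) ≤ 2 ^ 32 by norm_num]) hW0.le
    have h2 : W ^ 33 = W * W ^ 32 := by ring
    linarith
  have hblock : ∀ j ∈ Finset.range (J + 1), ∑ k ∈ Icc 1 X, ‖G j k‖ ≤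
      86 * ((H : ℝ) * X * Real.sqrt (1 + 2 * Real.log H) / (d * Real.sqrt W)) *
        (1 / Real.sqrt ((j : ℝ) + 1)) := by
    intro j _
    rcases (Qj j).eq_empty_or_nonempty with hempty | ⟨p₀, hp₀⟩
    · -- empty block
      have h0 : ∀ k, G j k = 0 := fun k =>
        Finset.sum_eq_zero fun p hp => absurd hp (by rw [hempty]; exact Finset.notMem_empty p)
      rw [Finset.sum_eq_zero (fun k _ => by rw [h0 k, norm_zero])]
      positivity
    · -- a nonempty block: `2^j ≥ P₁/2 ≥ 2W`, `2^j ≤ Q₁'`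
      obtain ⟨hp₀P, -⟩ := hQj j p₀ hp₀
      obtain ⟨hp₀P₁, hp₀Q₁⟩ := hPsb p₀ (hQjP j p₀ hp₀)
      have hPp₀ : (2 : ℝ) ^ j ≤ p₀ := by exact_mod_cast hp₀P
      have hPQ : (2 : ℝ) ^ j ≤ Q₁' := hPp₀.trans hp₀Q₁
      have hPW : 2 * W ≤ (2 : ℝ) ^ j := by
        have h2 : (p₀ : ℝ) < 2 * (2 : ℝ) ^ j := by exact_mod_cast (hQj j p₀ hp₀).2
        linarith
      have hPH : 2 * (2 : ℝ) ^ j * ((d : ℝ) * W) ≤ H :=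
        le_trans (mul_le_mul_of_nonneg_right (by linarith) (by positivity)) hQ₁'dW
      have h2PH : 2 * (2 : ℝ) ^ j ≤ H := le_trans (by linarith) hQ₁'H2
      exact block_bound_gen hW hd hH hHX (Qj j) (fun p hp => hPs p (hQjP j p hp)) (hQj j)
        hPW hPH h2PH hQ₁dW hQ₁1 hQ₁H hdWH c g hcle hg hα
  have hblocks : ∑ j ∈ Finset.range (J + 1), ∑ k ∈ Icc 1 X, ‖G j k‖ ≤
      516 * ((H : ℝ) * X * Real.log H / (d * Real.sqrt W)) := by
    calc ∑ j ∈ Finset.range (J + 1), ∑ k ∈ Icc 1 X, ‖G j k‖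
        ≤ ∑ j ∈ Finset.range (J + 1), 86 * ((H : ℝ) * X * Real.sqrt (1 + 2 * Real.log H) /
            (d * Real.sqrt W)) * (1 / Real.sqrt ((j : ℝ) + 1)) := Finset.sum_le_sum hblock
      _ = 86 * ((H : ℝ) * X * Real.sqrt (1 + 2 * Real.log H) / (d * Real.sqrt W)) *
            ∑ j ∈ Finset.range (J + 1), 1 / Real.sqrt ((j : ℝ) + 1) := by rw [Finset.mul_sum]
      _ ≤ 86 * ((H : ℝ) * X * Real.sqrt (1 + 2 * Real.log H) / (d * Real.sqrt W)) *
            (2 * Real.sqrt ((J + 1 : ℕ) : ℝ)) :=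
          mul_le_mul_of_nonneg_left (sum_inv_sqrt_le (J + 1)) (by positivity)
      _ = 172 * ((H : ℝ) * X / (d * Real.sqrt W)) *
            (Real.sqrt (1 + 2 * Real.log H) * Real.sqrt ((J + 1 : ℕ) : ℝ)) := by ring
      _ ≤ 172 * ((H : ℝ) * X / (d * Real.sqrt W)) * (3 * Real.log H) := by
          apply mul_le_mul_of_nonneg_left _ (by positivity)
          calc Real.sqrt (1 + 2 * Real.log H) * Real.sqrt ((J + 1 : ℕ) : ℝ)
              ≤ Real.sqrt (3 * Real.log H) * Real.sqrt (3 * Real.log H) :=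
                mul_le_mul (Real.sqrt_le_sqrt hΛ3) (Real.sqrt_le_sqrt hJ3) (Real.sqrt_nonneg _)
                  (Real.sqrt_nonneg _)
            _ = 3 * Real.log H := Real.mul_self_sqrt (by linarith)
      _ = 516 * ((H : ℝ) * X * Real.log H / (d * Real.sqrt W)) := by ring
  -- assembly
  calc ∑ k ∈ Icc 1 X, ‖twistedSum g ((windowDiv d H k).filter S) α‖
      ≤ ∑ k ∈ Icc 1 X, (∑ j ∈ Finset.range (J + 1), ‖G j k‖ +
          2 * ∑ p ∈ Ps, (#(windowDiv (d * p * p) H k) : ℝ)) := Finset.sum_le_sum hdecomp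
    _ = ∑ j ∈ Finset.range (J + 1), ∑ k ∈ Icc 1 X, ‖G j k‖ +
          2 * ∑ k ∈ Icc 1 X, ∑ p ∈ Ps, (#(windowDiv (d * p * p) H k) : ℝ) := by
        rw [Finset.sum_add_distrib, Finset.sum_comm, Finset.mul_sum]
    _ ≤ 516 * ((H : ℝ) * X * Real.log H / (d * Real.sqrt W)) +
          8 * ((H : ℝ) * X * Real.log H / (d * Real.sqrt W)) := add_le_add hblocks herr
    _ ≤ 600 * ((H : ℝ) * X * Real.log H / (d * Real.sqrt W)) := by
        have : 0 ≤ (H : ℝ) * X * Real.log H / (d * Real.sqrt W) := by positivity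
        linarith

end Literature.NumberTheory.Sieve.Lichtman2020

namespace Literature.NumberTheory.Sieve.Lichtman2020

open ArithmeticFunction

/-! ### §3.2 with decoupled arc width and threshold -/

/-- Numerics of the decoupled major arcs, I: the Abel windows are long enough,
`q(H/W_b + 1) ≤ H/d - 3` when `2qd ≤ W_b`, `4 ≤ W_b`, `W_b² ≤ H`, `q ≥ 1`. [folklore] -/
theorem majorArc_threshold_le_gen {H d q Wb : ℝ} (hWb : 4 ≤ Wb) (hd1 : 1 ≤ d) (hq1 : 1 ≤ q)
    (hqd : 2 * q * d ≤ Wb) (hH : Wb ^ 2 ≤ H) :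
    q * (H / Wb + 1) ≤ H / d - 3 := by
  have hWb0 : 0 < Wb := by linarith
  have hd0 : 0 < d := by linarith
  have hH0 : 0 ≤ H := le_trans (by positivity) hH
  -- (a) `qH/W_b ≤ H/(2d)`
  have ha : q * (H / Wb) ≤ H / (2 * d) := by
    rw [mul_div_assoc', div_le_div_iff₀ hWb0 (by positivity)]
    calc q * H * (2 * d) = (2 * q * d) * H := by ring
      _ ≤ Wb * H := mul_le_mul_of_nonneg_right hqd hH0
      _ = H * Wb := mul_comm _ _
  -- (b) `q + 3 ≤ H/(2d)`
  have hdW : 2 * d ≤ Wb := by nlinarith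
  have hb : q + 3 ≤ H / (2 * d) := by
    rw [le_div_iff₀ (by positivity)]
    have h1 : (q + 3) * (2 * d) = 2 * q * d + 3 * (2 * d) := by ring
    rw [h1]
    calc 2 * q * d + 3 * (2 * d) ≤ Wb + 3 * Wb := by linarith
      _ = 4 * Wb := by ring
      _ ≤ Wb * Wb := mul_le_mul_of_nonneg_right hWb hWb0.le
      _ = Wb ^ 2 := (sq Wb).symm
      _ ≤ H := hH
  have e : H / (2 * d) + H / (2 * d) = H / d := by field_simp; ring
  calc q * (H / Wb + 1) = q * (H / Wb) + q := by ring
    _ ≤ H / (2 * d) + (H / (2 * d) - 3) := by linarith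
    _ = H / d - 3 := by rw [← e]; ring

/-- Numerics of the decoupled major arcs, II: the assembly of (3.9)–(3.11) with width `Θ/(qH)` and
threshold `W_b`: `I_𝔐 ≪ I_{H/d} + (Θ/qH)(∑_{small h} hX + ∑_h qhX/W_b) ≪ HXΘ/(dW_b)` when `q ≤ Θ`,
`2qd ≤ W_b`, `2W_b ≤ H`. [cite: Lichtman2020, §3.2, (3.9)–(3.11)] -/
theorem majorArc_numerics_gen {H X d q Θ Wb L T ε C₁ A₁ A₂ : ℝ} (hWb : 0 < Wb) (hd1 : 1 ≤ d)
    (hq1 : 1 ≤ q) (hqΘ : q ≤ Θ) (hqd : 2 * q * d ≤ Wb) (hH : 2 * Wb ≤ H) (hX : 0 ≤ X) (hC₁ : 0 ≤ C₁)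
    (hL0 : 0 ≤ L) (hL : L ≤ H / d) (hε0 : 0 ≤ ε) (hε : ε ≤ 2 * Real.pi * Θ / (q * H))
    (hT : T = q * (H / Wb + 1))
    (hA₁ : A₁ ≤ 2 * (C₁ * L * q * X / Wb))
    (hA₂ : A₂ ≤ L * (C₁ * L * q * X / Wb) + (T + 1) * (X * (T + 1))) :
    A₁ + ε * A₂ ≤ (2 * C₁ + 2 * Real.pi * C₁ + 8 * Real.pi) * (H * X * Θ / (d * Wb)) := by
  have hd0 : 0 < d := by linarith
  have hq0 : 0 < q := by linarith
  have hΘ0 : 0 < Θ := by linarith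
  have hH0 : 0 < H := by linarith
  have hπ := Real.pi_pos.le
  set U : ℝ := H * X * Θ / (d * Wb) with hU
  have hU0 : 0 ≤ U := by positivity
  -- (i) the two long windows
  have h1 : C₁ * L * q * X / Wb ≤ C₁ * U := by
    calc C₁ * L * q * X / Wb ≤ C₁ * (H / d) * Θ * X / Wb := by gcongr
      _ = C₁ * U := by rw [hU]; field_simp
  -- (ii) the long Abel windows
  have h2 : ε * (L * (C₁ * L * q * X / Wb)) ≤ 2 * Real.pi * C₁ * U := by
    calc ε * (L * (C₁ * L * q * X / Wb))
        ≤ (2 * Real.pi * Θ / (q * H)) * ((H / d) * (C₁ * (H / d) * q * X / Wb)) := by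
          gcongr
      _ = 2 * Real.pi * C₁ * U / d := by rw [hU]; field_simp
      _ ≤ 2 * Real.pi * C₁ * U := div_le_self (by positivity) hd1
  -- (iii) the short Abel windows
  have hHWb : 2 ≤ H / Wb := by rw [le_div_iff₀ hWb]; linarith
  have hT1 : T + 1 ≤ 2 * (q * (H / Wb)) := by rw [hT]; nlinarith
  have hT0 : 0 ≤ T + 1 := by rw [hT]; positivity
  have h3 : ε * ((T + 1) * (X * (T + 1))) ≤ 8 * Real.pi * U := by
    calc ε * ((T + 1) * (X * (T + 1)))
        ≤ (2 * Real.pi * Θ / (q * H)) * ((2 * (q * (H / Wb))) * (X * (2 * (q * (H / Wb))))) := by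
          gcongr
      _ = 8 * Real.pi * U * (2 * q * d / Wb) / 2 := by rw [hU]; field_simp; ring
      _ ≤ 8 * Real.pi * U * 1 / 2 := by
          gcongr
          rw [div_le_one hWb]
          exact hqd
      _ ≤ 8 * Real.pi * U := by nlinarith
  have hA₂' : ε * A₂ ≤ ε * (L * (C₁ * L * q * X / Wb) + (T + 1) * (X * (T + 1))) :=
    mul_le_mul_of_nonneg_left hA₂ hε0
  rw [mul_add] at hA₂'
  nlinarith

/-- **Lichtman's major arc argument at a fixed `X`, decoupled form** (as `majorArc_fixed_bound`,
pp. 10–11, with the arc width `Θ/(qH)` and the threshold `W_b` as free parameters): for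
`α = a/q + θ`, `|θ| ≤ Θ/(qH)`, `1 ≤ q ≤ Θ`, `2qd ≤ W_b`, `4 ≤ W_b`, `W_b² ≤ H`, `dW_b ≤ X`, a set `S`
invariant under the divisors of `q`, and the mean-square bound `J ≤ C h²Y/W_b²` (discretised) for the
moduli `q/c` (`c ∣ q`), the window lengths `h ∈ [H/W_b, H]` and the blocks `X/(dW_b) ≤ Y ≤ X`, one has
`∑_{k ≤ X} |∑_{k ≤ md ≤ k+H-1, m ∈ S} λ(m) e(mα)| ≤ C' HXΘ/(dW_b)` with `C' = 2C₁ + 2πC₁ + 8π`,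
`C₁ = 6 + 12√C`.  Steps as in `majorArc_fixed_bound`: Abel summation in `θ` ((3.9)), residues,
`c = (b, q)`, characters ((3.12)), `sum_twistedWindow_le` (with its `W` taken as `W_b^{1/5}`), and
`majorArc_numerics_gen`. [cite: Lichtman2020, Proposition 3.2 (proof), pp. 10–11] -/
theorem majorArc_fixed_bound_gen {X H d q : ℕ} {a : ℤ} {θ Θ Wb C : ℝ} (S : ℕ → Prop)
    [DecidablePred S] (hX : 1 ≤ X) (hd : 1 ≤ d) (hq : 1 ≤ q) (hqΘ : (q : ℝ) ≤ Θ)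
    (hqd : 2 * (q : ℝ) * d ≤ Wb) (hWb : 4 ≤ Wb) (hHW : Wb ^ 2 ≤ H) (hXW : (d : ℝ) * Wb ≤ X)
    (hθ : |θ| ≤ Θ / (q * H)) (hC : 0 ≤ C)
    (hS : ∀ c ∈ q.divisors, ∀ m, S (c * m) ↔ S m)
    (h34 : ∀ c ∈ q.divisors, ∀ χ : DirichletCharacter ℂ (q / c), ∀ h : ℕ,
      (H : ℝ) / Wb ≤ h → h ≤ H → ∀ Y : ℕ, (X : ℝ) / (d * Wb) ≤ Y → Y ≤ X →
        ∑ k ∈ Ioc Y (2 * Y), ‖∑ m ∈ (Icc k (k + h - 1)).filter S,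
            χ (m : ZMod (q / c)) * ((liouville m : ℤ) : ℂ)‖ ^ 2 ≤ C * ((h : ℝ) ^ 2 * Y / Wb ^ 2)) :
    ∑ k ∈ Icc 1 X, ‖∑ m ∈ (windowDiv d H k).filter S,
        ((liouville m : ℤ) : ℂ) * (𝐞 ((m : ℝ) * (a / q + θ)) : ℂ)‖ ≤
      (2 * (6 + 12 * Real.sqrt C) + 2 * Real.pi * (6 + 12 * Real.sqrt C) + 8 * Real.pi) *
        ((H : ℝ) * X * Θ / (d * Wb)) := by
  -- positivity bookkeeping
  have hWb0 : (0 : ℝ) < Wb := by linarith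
  have hWb1 : (1 : ℝ) ≤ Wb := by linarith
  have hd0 : 0 < d := hd
  have hq0 : 0 < q := hq
  have hd1 : (1 : ℝ) ≤ d := by exact_mod_cast hd
  have hq1 : (1 : ℝ) ≤ q := by exact_mod_cast hq
  have hWb2 : (16 : ℝ) ≤ Wb ^ 2 := by nlinarith
  have hH16 : (16 : ℝ) ≤ H := hWb2.trans hHW
  have hH1 : 1 ≤ H := by exact_mod_cast (show (1 : ℝ) ≤ H by linarith)
  have hX0 : (0 : ℝ) ≤ X := Nat.cast_nonneg X
  have hH2Wb : 2 * Wb ≤ (H : ℝ) := by nlinarith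
  -- the fifth root of `W_b`, to feed `sum_twistedWindow_le`
  set W₅ : ℝ := Wb ^ ((1 : ℝ) / 5) with hW₅def
  have hW₅0 : 0 < W₅ := Real.rpow_pos_of_pos hWb0 _
  have hW₅5 : W₅ ^ 5 = Wb := by
    rw [hW₅def, ← Real.rpow_natCast, ← Real.rpow_mul hWb0.le]; norm_num
  have hW₅10 : W₅ ^ 10 = Wb ^ 2 := by
    rw [show (10 : ℕ) = 5 * 2 from rfl, pow_mul, hW₅5]
  -- `ε = |e(θ) - 1| ≤ 2π Θ/(qH)`
  obtain ⟨ε, hεdef⟩ : ∃ ε : ℝ, ε = ‖(𝐞 θ : ℂ) - 1‖ := ⟨_, rfl⟩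
  have hε0 : 0 ≤ ε := by rw [hεdef]; exact norm_nonneg _
  have hε : ε ≤ 2 * Real.pi * Θ / (q * H) := by
    calc ε ≤ 2 * Real.pi * |θ| := by rw [hεdef]; exact norm_fourierChar_sub_one_le θ
      _ ≤ 2 * Real.pi * (Θ / (q * H)) :=
          mul_le_mul_of_nonneg_left hθ (by positivity)
      _ = _ := by ring
  -- the window sums `P(n₀, j)` with the additive character `e(·a/q)` (kept opaque)
  obtain ⟨P, hP⟩ : ∃ P : ℕ → ℕ → ℝ, ∀ n₀ j, P n₀ j = ‖∑ m ∈ (Icc n₀ (n₀ + j)).filter S,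
      ((liouville m : ℤ) : ℂ) * (𝐞 ((m : ℝ) * (a / q)) : ℂ)‖ := ⟨_, fun _ _ => rfl⟩
  have hP0 : ∀ n₀ j, 0 ≤ P n₀ j := fun n₀ j => by rw [hP]; exact norm_nonneg _
  have hg1 : ∀ m : ℕ, ‖((liouville m : ℤ) : ℂ) * (𝐞 ((m : ℝ) * (a / q)) : ℂ)‖ ≤ 1 := by
    intro m
    rw [norm_mul, norm_fourierChar, mul_one]
    exact norm_liouville_le_one m
  have hPtriv : ∀ n₀ j, P n₀ j ≤ j + 1 := fun n₀ j => by
    rw [hP]; exact norm_sum_filter_Icc_le n₀ j _ hg1 S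
  obtain ⟨L, hLdef⟩ : ∃ L : ℕ, L = (H - 1) / d := ⟨_, rfl⟩
  -- Step 1: Abel summation on each window
  have hterm : ∀ k ∈ Icc 1 X,
      ‖∑ m ∈ (windowDiv d H k).filter S,
          ((liouville m : ℤ) : ℂ) * (𝐞 ((m : ℝ) * (a / q + θ)) : ℂ)‖ ≤
        P ((k + d - 1) / d) (L - 1) + P ((k + d - 1) / d) L +
          ε * ∑ j ∈ range L, P ((k + d - 1) / d) j := by
    intro k hk
    have hk1 : 1 ≤ k := (Finset.mem_Icc.mp hk).1
    have hsum0 : 0 ≤ ∑ j ∈ range L, P ((k + d - 1) / d) j :=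
      Finset.sum_nonneg fun j _ => hP0 _ _
    have hRHS0 : 0 ≤ P ((k + d - 1) / d) (L - 1) + P ((k + d - 1) / d) L +
        ε * ∑ j ∈ range L, P ((k + d - 1) / d) j :=
      add_nonneg (add_nonneg (hP0 _ _) (hP0 _ _)) (mul_nonneg hε0 hsum0)
    rw [windowDiv_eq_Icc hd0 hk1]
    obtain ⟨m₀, hm₀⟩ : ∃ m₀ : ℕ, m₀ = (k + d - 1) / d := ⟨_, rfl⟩
    obtain ⟨M, hM⟩ : ∃ M : ℕ, M = (k + H - 1) / d := ⟨_, rfl⟩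
    rw [← hm₀, ← hM]
    by_cases hle : m₀ ≤ M
    · obtain ⟨n, hn⟩ := Nat.exists_eq_add_of_le hle
      -- `n ∈ {L-1, L}`
      have hnL : n ≤ L ∧ L ≤ n + 1 := by
        have e₁ := Nat.div_add_mod (k + d - 1) d
        have r₁ := Nat.mod_lt (k + d - 1) hd0
        have e₂ := Nat.div_add_mod (k + H - 1) d
        have r₂ := Nat.mod_lt (k + H - 1) hd0
        have e₃ := Nat.div_add_mod (H - 1) d
        have r₃ := Nat.mod_lt (H - 1) hd0
        rw [← hm₀] at e₁
        rw [← hM, hn, Nat.mul_add] at e₂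
        rw [← hLdef] at e₃
        have g1 : d * n < d * (L + 1) := by
          rw [Nat.mul_add, Nat.mul_one]
          generalize d * m₀ = A at e₁ e₂
          generalize d * n = B at e₂
          generalize d * L = E at e₃
          omega
        have g2 : d * L < d * (n + 2) := by
          rw [Nat.mul_add]
          generalize d * m₀ = A at e₁ e₂
          generalize d * n = B at e₂
          generalize d * L = E at e₃
          omega
        exact ⟨Nat.lt_succ_iff.mp (Nat.lt_of_mul_lt_mul_left g1),
          by have := Nat.lt_of_mul_lt_mul_left g2; omega⟩
      rw [hn]
      -- factor `e(mα) = e(ma/q) e(mθ)` and move `𝟙_S` into the coefficient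
      obtain ⟨f, hf⟩ : ∃ f : ℕ → ℂ, ∀ m, f m = if S m then
          ((liouville m : ℤ) : ℂ) * (𝐞 ((m : ℝ) * (a / q)) : ℂ) else 0 := ⟨_, fun _ => rfl⟩
      have hrew : ∀ s : Finset ℕ, ∑ m ∈ s.filter S,
          ((liouville m : ℤ) : ℂ) * (𝐞 ((m : ℝ) * (a / q + θ)) : ℂ) =
            ∑ m ∈ s, f m * (𝐞 ((m : ℝ) * θ) : ℂ) := by
        intro s
        rw [Finset.sum_filter]
        refine Finset.sum_congr rfl fun m _ => ?_
        rw [hf]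
        split_ifs
        · rw [mul_add, AddChar.map_add_eq_mul, Circle.coe_mul]; ring
        · rw [zero_mul]
      have hPf : ∀ j, ‖∑ m ∈ Icc m₀ (m₀ + j), f m‖ = P m₀ j := by
        intro j
        rw [hP, Finset.sum_filter]
        simp only [hf]
      rw [hrew]
      refine (norm_sum_Icc_mul_fourierChar_le f θ m₀ n).trans ?_
      rw [hPf, ← hεdef]
      simp only [hPf]
      -- `P(m₀, n) ≤ P(m₀, L-1) + P(m₀, L)` and `∑_{j<n} ≤ ∑_{j<L}`
      have h1 : P m₀ n ≤ P m₀ (L - 1) + P m₀ L := by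
        rcases Nat.eq_or_lt_of_le hnL.1 with h | h
        · rw [h]; linarith [hP0 m₀ (L - 1)]
        · have : n = L - 1 := by omega
          rw [this]; linarith [hP0 m₀ L]
      have h2 : ∑ j ∈ range n, P m₀ j ≤ ∑ j ∈ range L, P m₀ j :=
        Finset.sum_le_sum_of_subset_of_nonneg (Finset.range_subset_range.mpr hnL.1)
          fun _ _ _ => hP0 _ _
      have := mul_le_mul_of_nonneg_left h2 hε0
      linarith
    · -- empty window
      have hempty : Icc m₀ M = ∅ := Finset.Icc_eq_empty_of_lt (by omega)
      rw [hempty, Finset.filter_empty, Finset.sum_empty, norm_zero]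
      subst hm₀
      exact hRHS0
  -- Step 2: sum over `k`; the sums `I'(j) = ∑_k P(⌈k/d⌉, j)` (kept opaque)
  obtain ⟨I', hI'⟩ : ∃ I' : ℕ → ℝ, ∀ j, I' j = ∑ k ∈ Icc 1 X, P ((k + d - 1) / d) j :=
    ⟨_, fun _ => rfl⟩
  have hstep2 : ∑ k ∈ Icc 1 X, ‖∑ m ∈ (windowDiv d H k).filter S,
      ((liouville m : ℤ) : ℂ) * (𝐞 ((m : ℝ) * (a / q + θ)) : ℂ)‖ ≤
        I' (L - 1) + I' L + ε * ∑ j ∈ range L, I' j := by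
    refine (Finset.sum_le_sum hterm).trans (le_of_eq ?_)
    simp only [hI']
    rw [Finset.sum_add_distrib, Finset.sum_add_distrib, ← Finset.mul_sum, Finset.sum_comm]
  -- Step 3a: the trivial bound `I'(j) ≤ X (j+1)`
  have hI'triv : ∀ j, I' j ≤ X * (j + 1) := by
    intro j
    rw [hI']
    calc ∑ k ∈ Icc 1 X, P ((k + d - 1) / d) j ≤ ∑ k ∈ Icc 1 X, ((j : ℝ) + 1) :=
          Finset.sum_le_sum fun k _ => hPtriv _ _
      _ = X * (j + 1) := by rw [Finset.sum_const, Nat.card_Icc, nsmul_eq_mul, Nat.add_sub_cancel]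
  -- Step 3b: the bound from the mean square for `q(H/W_b + 1) ≤ j ≤ H - 1`
  obtain ⟨T, hT⟩ : ∃ T : ℝ, T = (q : ℝ) * (H / Wb + 1) := ⟨_, rfl⟩
  have hT0 : 0 ≤ T := by rw [hT]; positivity
  obtain ⟨C₁, hC₁⟩ : ∃ C₁ : ℝ, C₁ = 6 + 12 * Real.sqrt C := ⟨_, rfl⟩
  have hC₁0 : 0 ≤ C₁ := by rw [hC₁]; positivity
  obtain ⟨N, hNdef⟩ : ∃ N : ℕ, N = (X + d - 1) / d := ⟨_, rfl⟩
  obtain ⟨M₀, hM₀⟩ : ∃ M₀ : ℕ, M₀ = ⌈(X : ℝ) / (d * Wb)⌉₊ := ⟨_, rfl⟩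
  have hN1 : 1 ≤ N := by rw [hNdef]; exact (Nat.le_div_iff_mul_le hd0).mpr (by omega)
  have hNX : N ≤ X := by
    rw [hNdef, Nat.div_le_iff_le_mul_add_pred hd0]
    have := Nat.mul_le_mul_right X hd
    rw [one_mul] at this
    omega
  have hdWX : (d : ℝ) * Wb ≤ X := hXW
  have hM₀1 : 1 ≤ M₀ := by
    rw [hM₀, Nat.one_le_ceil_iff]
    have : (0 : ℝ) < X := by
      have : (1 : ℝ) ≤ X := by exact_mod_cast hX
      linarith
    positivity
  have hM₀ge : (X : ℝ) / (d * Wb) ≤ M₀ := by rw [hM₀]; exact Nat.le_ceil _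
  have hdM₀ : (d : ℝ) * M₀ ≤ 2 * X / Wb := by
    have h1 : (M₀ : ℝ) < X / (d * Wb) + 1 := by
      rw [hM₀]; exact Nat.ceil_lt_add_one (by positivity)
    have h2 : (d : ℝ) * M₀ ≤ d * (X / (d * Wb) + 1) :=
      mul_le_mul_of_nonneg_left h1.le (by positivity)
    have h3 : (d : ℝ) * (X / (d * Wb) + 1) = X / Wb + d := by field_simp
    have h4 : (d : ℝ) ≤ X / Wb := by rw [le_div_iff₀ hWb0]; exact hdWX
    rw [h3] at h2
    calc (d : ℝ) * M₀ ≤ X / Wb + d := h2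
      _ ≤ X / Wb + X / Wb := by linarith
      _ = 2 * X / Wb := by ring
  have hdN : (d : ℝ) * N ≤ 2 * X := by
    have h1 : d * N ≤ X + d - 1 := by rw [hNdef]; exact Nat.mul_div_le (X + d - 1) d
    have h2 : ((d * N : ℕ) : ℝ) ≤ ((X + d - 1 : ℕ) : ℝ) := by exact_mod_cast h1
    have h3 : (d : ℝ) ≤ X := by
      calc (d : ℝ) ≤ d * Wb := le_mul_of_one_le_right (by positivity) hWb1
        _ ≤ X := hdWX
    push_cast [show 1 ≤ X + d by omega] at h2
    linarith
  have hI'good : ∀ j : ℕ, T ≤ j → j + 1 ≤ H → I' j ≤ C₁ * j * q * X / Wb := by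
    intro j hjT hjH
    rw [hT] at hjT
    have hjT' : (q : ℝ) * (H / W₅ ^ 5 + 1) ≤ j := by rwa [hW₅5]
    have hU := sum_twistedWindow_le (q := q) (N := N) (M₀ := M₀) (H := H) (j := j) (a := a)
      (C := C) (W := W₅) S hq0 hS hW₅0 hC hM₀1 hN1 hjT' hjH (fun c hc χ h hh1 hh2 Y hY1 hY2 => by
        rw [hW₅10]
        rw [hW₅5] at hh1
        exact h34 c hc χ h hh1 hh2 Y (hM₀ge.trans (by exact_mod_cast hY1)) (hY2.trans hNX))
    rw [hW₅5] at hU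
    simp only [← hP] at hU
    have hceil := sum_Icc_ceilDiv_le hd0 X (fun n₀ => P n₀ j) fun n₀ => hP0 n₀ j
    rw [← hNdef] at hceil
    rw [hI']
    calc ∑ k ∈ Icc 1 X, P ((k + d - 1) / d) j ≤ (d : ℝ) * ∑ n₀ ∈ Icc 1 N, P n₀ j := hceil
      _ ≤ (d : ℝ) * (3 * j * q * (M₀ + 2 * Real.sqrt C * N / Wb)) :=
          mul_le_mul_of_nonneg_left hU (by positivity)
      _ = 3 * j * q * ((d : ℝ) * M₀ + 2 * Real.sqrt C * ((d : ℝ) * N) / Wb) := by ring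
      _ ≤ 3 * j * q * (2 * X / Wb + 2 * Real.sqrt C * (2 * X) / Wb) := by gcongr
      _ = C₁ * j * q * X / Wb := by rw [hC₁]; ring
  -- Step 4: the numerics
  have hLreal : (L : ℝ) ≤ H / d := by
    rw [hLdef]
    calc (((H - 1) / d : ℕ) : ℝ) ≤ ((H - 1 : ℕ) : ℝ) / d := Nat.cast_div_le
      _ ≤ H / d := by
          gcongr
          exact_mod_cast Nat.sub_le H 1
  have hLge : (H : ℝ) / d - 2 ≤ L := by
    have h1 := sub_one_le_natDiv (H - 1) hd0
    have h2 : (((H - 1 : ℕ)) : ℝ) = H - 1 := by push_cast [hH1]; ring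
    rw [h2, ← hLdef] at h1
    have h3 : (H : ℝ) / d - 1 ≤ ((H : ℝ) - 1) / d := by
      rw [sub_div]
      have : (1 : ℝ) / d ≤ 1 := by rw [div_le_one (by positivity)]; exact hd1
      linarith
    linarith
  have hthr : T ≤ (H : ℝ) / d - 3 := by
    rw [hT]; exact majorArc_threshold_le_gen hWb hd1 hq1 hqd hHW
  have hL1 : 1 ≤ L := by
    have : (0 : ℝ) < L := by linarith
    exact_mod_cast (show 0 < L by exact_mod_cast this)
  have hLH : L + 1 ≤ H := by
    have : L ≤ H - 1 := by rw [hLdef]; exact Nat.div_le_self _ _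
    omega
  have hcastL1 : ((L - 1 : ℕ) : ℝ) = L - 1 := by push_cast [hL1]; ring
  have hTL1 : T ≤ ((L - 1 : ℕ) : ℝ) := by rw [hcastL1]; linarith
  have hTL : T ≤ (L : ℝ) := by linarith
  -- `A₁ = I'(L-1) + I'(L)`
  have hA₁ : I' (L - 1) + I' L ≤ 2 * (C₁ * L * q * X / Wb) := by
    have h1 := hI'good (L - 1) hTL1 (by omega)
    have h2 := hI'good L hTL hLH
    rw [hcastL1] at h1
    have h3 : C₁ * ((L : ℝ) - 1) * q * X / Wb ≤ C₁ * L * q * X / Wb := by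
      have e1 : 0 ≤ C₁ * q * X / Wb := by positivity
      have e2 : C₁ * ((L : ℝ) - 1) * q * X / Wb =
          C₁ * L * q * X / Wb - C₁ * q * X / Wb := by ring
      linarith
    linarith
  -- `A₂ = ∑_{j<L} I'(j)`
  have hA₂ : ∑ j ∈ range L, I' j ≤ L * (C₁ * L * q * X / Wb) + (T + 1) * (X * (T + 1)) := by
    have hpt : ∀ j ∈ range L, I' j ≤
        C₁ * L * q * X / Wb + (if (j : ℝ) < T then X * (T + 1) else 0) := by
      intro j hj
      rw [Finset.mem_range] at hj
      by_cases hjT : (j : ℝ) < T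
      · rw [if_pos hjT]
        have h1 := hI'triv j
        have h2 : (X : ℝ) * (j + 1) ≤ X * (T + 1) := by gcongr
        have h3 : 0 ≤ C₁ * L * q * X / Wb := by positivity
        linarith
      · rw [if_neg hjT, add_zero]
        push Not at hjT
        have h1 := hI'good j hjT (by omega)
        have hjL : (j : ℝ) ≤ L := by exact_mod_cast hj.le
        have h2 : C₁ * j * q * X / Wb ≤ C₁ * L * q * X / Wb := by gcongr
        linarith
    refine (Finset.sum_le_sum hpt).trans ?_
    rw [Finset.sum_add_distrib, Finset.sum_const, Finset.card_range, nsmul_eq_mul,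
      ← Finset.sum_filter, Finset.sum_const, nsmul_eq_mul]
    have hX1 : 0 ≤ (X : ℝ) * (T + 1) := by positivity
    -- `#{j < L : j < T} ≤ ⌈T⌉ ≤ T + 1`
    have hsub : (range L).filter (fun j : ℕ => (j : ℝ) < T) ⊆ range ⌈T⌉₊ := by
      intro j hj
      rw [Finset.mem_filter] at hj
      exact Finset.mem_range.mpr (Nat.lt_ceil.mpr hj.2)
    have hcard : (#((range L).filter (fun j : ℕ => (j : ℝ) < T)) : ℝ) ≤ T + 1 := by
      calc (#((range L).filter (fun j : ℕ => (j : ℝ) < T)) : ℝ) ≤ #(range ⌈T⌉₊) := by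
            exact_mod_cast Finset.card_le_card hsub
        _ = ⌈T⌉₊ := by rw [Finset.card_range]
        _ ≤ T + 1 := (Nat.ceil_lt_add_one hT0).le
    have hmul := mul_le_mul_of_nonneg_right hcard hX1
    linarith
  have hfin := majorArc_numerics_gen (A₁ := I' (L - 1) + I' L) (A₂ := ∑ j ∈ range L, I' j)
    hWb0 hd1 hq1 hqΘ hqd hH2Wb hX0 hC₁0 (Nat.cast_nonneg L) hLreal hε0 hε hT hA₁ hA₂
  rw [hC₁] at hfin
  exact hstep2.trans hfin

end Literature.NumberTheory.Sieve.Lichtman2020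

namespace Literature.NumberTheory.Sieve.Lichtman2020

/-! ### Theorem 2.2 at a fixed `X` from per-modulus bounds, with a free number of moduli -/

/-- **Theorem 2.2 at a fixed `X` from a general per-modulus bound and a free cut-off `M`** (variant
of `keyFourier_fixed_bound_general`, whose cut-off is `⌊√W⌋`): if for every `e ≤ M` and every `β`
`∑_{k ≤ X} |∑_{n ∈ windowDiv e² H k ∩ S} λ(n)e(nβ)| ≤ C HX B(e)`, and `S(e²m) ↔ S(m)` for `e ≤ M`, then
`∑_{k ≤ X} |∑_{n ∈ {k..k+H-1} ∩ S} μ(n)e(nα)| ≤ C HX ∑_{e ≤ M} B(e) + 2HX/M`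
(`μ(n) = ∑_{e² ∣ n} μ(e) λ(n/e²)`, the moduli `e > M` by the trivial bound and `∑_{e > M} e⁻² ≤ M⁻¹`).
[cite: Lichtman2020, §2, (2.9)–(2.11)] -/
theorem keyFourier_fixed_bound_M {X H M D : ℕ} {C : ℝ} (B : ℕ → ℝ) (S : ℕ → Prop)
    [DecidablePred S] (α : ℝ) (hH : 1 ≤ H) (hHX : H ≤ X) (hM1 : 1 ≤ M) (hD : X + H ≤ D)
    (hP : ∀ e : ℕ, 1 ≤ e → e ≤ M → ∀ β : ℝ,
      ∑ k ∈ Icc 1 X, ‖liouvilleTwistedSum ((windowDiv (e ^ 2) H k).filter S) β‖ ≤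
        C * ((H : ℝ) * X) * B e)
    (hS : ∀ e : ℕ, 1 ≤ e → e ≤ M → ∀ m : ℕ, S (e ^ 2 * m) ↔ S m) :
    ∑ k ∈ Icc 1 X, ‖moebiusTwistedSum ((Icc k (k + H - 1)).filter S) α‖ ≤
      C * ((H : ℝ) * X) * ∑ e ∈ Icc 1 M, B e + 2 * ((H : ℝ) * X) / M := by
  have hX0 : (0 : ℝ) ≤ X := Nat.cast_nonneg _
  have hH0 : (0 : ℝ) ≤ H := Nat.cast_nonneg _
  have hHX' : (H : ℝ) ≤ X := by exact_mod_cast hHX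
  have hM0 : (0 : ℝ) < M := by exact_mod_cast (by omega : 0 < M)
  set T : ℕ → ℕ → ℂ := fun d k =>
    ∑ m ∈ (windowDiv (d ^ 2) H k).filter (fun m => S (d ^ 2 * m)),
      ((ArithmeticFunction.liouville m : ℤ) : ℂ) * (𝐞 (((d ^ 2 * m : ℕ) : ℝ) * α) : ℂ) with hT
  have hstep1 : ∀ k ∈ Icc 1 X, ‖moebiusTwistedSum ((Icc k (k + H - 1)).filter S) α‖ ≤
      ∑ d ∈ Icc 1 D, ‖T d k‖ := by
    intro k hk
    rw [Finset.mem_Icc] at hk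
    rw [moebiusTwistedSum_filter_Icc_eq k H D hk.1 (by omega) S α]
    refine (norm_sum_le _ _).trans (Finset.sum_le_sum fun d _ => ?_)
    rw [norm_mul]
    have hμ : ‖((ArithmeticFunction.moebius d : ℤ) : ℂ)‖ ≤ 1 := by
      rw [Complex.norm_intCast]
      exact_mod_cast (ArithmeticFunction.abs_moebius_le_one (n := d))
    calc ‖((ArithmeticFunction.moebius d : ℤ) : ℂ)‖ * ‖T d k‖ ≤ 1 * ‖T d k‖ :=
          mul_le_mul_of_nonneg_right hμ (norm_nonneg _)
      _ = ‖T d k‖ := one_mul _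
  have htriv : ∀ d k, ‖T d k‖ ≤ #(windowDiv (d ^ 2) H k) := by
    intro d k
    refine (norm_sum_le _ _).trans ?_
    calc ∑ m ∈ (windowDiv (d ^ 2) H k).filter (fun m => S (d ^ 2 * m)),
          ‖((ArithmeticFunction.liouville m : ℤ) : ℂ) * (𝐞 (((d ^ 2 * m : ℕ) : ℝ) * α) : ℂ)‖
        ≤ ∑ m ∈ (windowDiv (d ^ 2) H k).filter (fun m => S (d ^ 2 * m)), (1 : ℝ) := by
          refine Finset.sum_le_sum fun m _ => ?_
          rw [norm_mul, Complex.norm_intCast, norm_fourierChar, mul_one]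
          exact_mod_cast abs_liouville_le_one m
      _ = #((windowDiv (d ^ 2) H k).filter (fun m => S (d ^ 2 * m))) := by simp
      _ ≤ #(windowDiv (d ^ 2) H k) := by exact_mod_cast Finset.card_filter_le _ _
  have hsmall : ∀ d ∈ Icc 1 M, ∑ k ∈ Icc 1 X, ‖T d k‖ ≤ C * ((H : ℝ) * X) * B d := by
    intro d hd
    rw [Finset.mem_Icc] at hd
    have hTeq : ∀ k, T d k =
        liouvilleTwistedSum ((windowDiv (d ^ 2) H k).filter S) ((d : ℝ) ^ 2 * α) := by
      intro k
      rw [hT, liouvilleTwistedSum]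
      simp only
      rw [Finset.filter_congr (fun m _ => hS d hd.1 hd.2 m)]
      refine Finset.sum_congr rfl fun m _ => ?_
      congr 2
      push_cast
      ring
    simp_rw [hTeq]
    exact hP d hd.1 hd.2 ((d : ℝ) ^ 2 * α)
  have hlarge : ∀ d ∈ Ioc M D, ∑ k ∈ Icc 1 X, ‖T d k‖ ≤ 2 * ((H : ℝ) * X) * ((d : ℝ) ^ 2)⁻¹ := by
    intro d hd
    rw [Finset.mem_Ioc] at hd
    calc ∑ k ∈ Icc 1 X, ‖T d k‖ ≤ ∑ k ∈ Icc 1 X, (#(windowDiv (d ^ 2) H k) : ℝ) :=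
          Finset.sum_le_sum fun k _ => htriv d k
      _ ≤ (H : ℝ) * ((X : ℝ) + H) / ((d ^ 2 : ℕ) : ℝ) :=
          sum_card_windowDiv_le X H (d ^ 2) (Nat.one_le_pow _ _ (by omega)) hH
      _ ≤ (H : ℝ) * ((X : ℝ) + X) / ((d ^ 2 : ℕ) : ℝ) := by
          apply div_le_div_of_nonneg_right _ (by positivity)
          exact mul_le_mul_of_nonneg_left (by linarith) hH0
      _ = 2 * ((H : ℝ) * X) * ((d : ℝ) ^ 2)⁻¹ := by push_cast; ring
  have hsum_small : ∑ d ∈ Icc 1 M, ∑ k ∈ Icc 1 X, ‖T d k‖ ≤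
      C * ((H : ℝ) * X) * ∑ d ∈ Icc 1 M, B d := by
    rw [Finset.mul_sum]
    exact Finset.sum_le_sum hsmall
  have hsum_large : ∑ d ∈ Ioc M D, ∑ k ∈ Icc 1 X, ‖T d k‖ ≤ 2 * ((H : ℝ) * X) / M := by
    rcases le_or_gt M D with hMD | hMD
    · calc ∑ d ∈ Ioc M D, ∑ k ∈ Icc 1 X, ‖T d k‖
          ≤ ∑ d ∈ Ioc M D, 2 * ((H : ℝ) * X) * ((d : ℝ) ^ 2)⁻¹ := Finset.sum_le_sum hlarge
        _ = 2 * ((H : ℝ) * X) * ∑ d ∈ Ioc M D, ((d : ℝ) ^ 2)⁻¹ := by rw [Finset.mul_sum]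
        _ ≤ 2 * ((H : ℝ) * X) * (M : ℝ)⁻¹ := by
            apply mul_le_mul_of_nonneg_left _ (by positivity)
            have h1 := sum_Ioc_inv_sq_le_sub (α := ℝ) (by omega : M ≠ 0) hMD
            have h2 : 0 ≤ (D : ℝ)⁻¹ := by positivity
            linarith
        _ = 2 * ((H : ℝ) * X) / M := by rw [div_eq_mul_inv]
    · rw [Finset.Ioc_eq_empty (by omega), Finset.sum_empty]
      positivity
  calc ∑ k ∈ Icc 1 X, ‖moebiusTwistedSum ((Icc k (k + H - 1)).filter S) α‖
      ≤ ∑ k ∈ Icc 1 X, ∑ d ∈ Icc 1 D, ‖T d k‖ := Finset.sum_le_sum hstep1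
    _ = ∑ d ∈ Icc 1 D, ∑ k ∈ Icc 1 X, ‖T d k‖ := Finset.sum_comm
    _ = ∑ d ∈ (Icc 1 D).filter (fun d => d ≤ M), ∑ k ∈ Icc 1 X, ‖T d k‖ +
          ∑ d ∈ (Icc 1 D).filter (fun d => ¬ d ≤ M), ∑ k ∈ Icc 1 X, ‖T d k‖ :=
        (Finset.sum_filter_add_sum_filter_not _ _ _).symm
    _ ≤ ∑ d ∈ Icc 1 M, ∑ k ∈ Icc 1 X, ‖T d k‖ + ∑ d ∈ Ioc M D, ∑ k ∈ Icc 1 X, ‖T d k‖ := by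
        apply add_le_add
        · refine Finset.sum_le_sum_of_subset_of_nonneg ?_ fun d _ _ =>
            Finset.sum_nonneg fun k _ => norm_nonneg _
          intro d hd
          rw [Finset.mem_filter, Finset.mem_Icc] at hd
          rw [Finset.mem_Icc]
          exact ⟨hd.1.1, hd.2⟩
        · refine Finset.sum_le_sum_of_subset_of_nonneg ?_ fun d _ _ =>
            Finset.sum_nonneg fun k _ => norm_nonneg _
          intro d hd
          rw [Finset.mem_filter, Finset.mem_Icc] at hd
          rw [Finset.mem_Ioc]
          exact ⟨by omega, hd.1.2⟩
    _ ≤ _ := add_le_add hsum_small hsum_large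

end Literature.NumberTheory.Sieve.Lichtman2020
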